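import Mathlib.CategoryTheory.Galois.Decomposition
import Mathlib.CategoryTheory.SingleObj
import Mathlib.Data.PNat.Basic
import Literature.AlgebraicGeometry.Frobenioids.BaseCategoryTheoreticityDefs
import HarnessLib

/-!
# Frobenioids I, Remark 3.1.3: the proof of the named fact `Remark313`

Mochizuki, *The geometry of Frobenioids I: the general theory*, Kyushu J. Math. **62** (2008)
293–400, Rem. 3.1.3, kurims text p. 58 [cite: MochizukiFrdI2008, Rem. 3.1.3 p.58]. The sibling file
`BaseCategoryTheoreticityDefs.lean` (abc-iut-L1-t3) types the checkable content of Remark 3.1.3 as the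
named fact `Remark313`:

* the one-object category determined by the monoid `N_{≥1}` is not of FSMFF-type;
* `Order(ℤ_{≥0})` (`DivOrder (Multiplicative ℕ)` of `Monoids.lean`) is not of FSMFF-type;
* "a typical example of a 'base category' is constituted by the subcategory of connected objects of a
  Galois category [which is easily verified to be of FSM- (hence also of FSMFF-) type]".

This PROOF-ONLY companion discharges it (`Remark313_holds`) without touching that signature, and records
the reusable lemmas behind the third clause, for the base categories `B(G)⁰`, `B^temp(Π)⁰` used
throughout [FrdII], [EtTh], [IUTchI]: in a Galois category the connected objects in the sense of FrdI §0
p. 15 (nonempty, not a coproduct of two nonempty objects; `IsConnectedObj` of `Categories.lean`) are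
exactly the connected objects in the sense of SGA1 (Mathlib's `PreGaloisCategory.IsConnected`); a
monomorphism of the full subcategory `C⁰` of connected objects is a monomorphism of `C` (test on the
decomposition into connected components, Mathlib `has_decomp_connected_components`), hence an
isomorphism. Proof of the first clause: `2 ∈ N_{≥1}` is a non-invertible FSM-morphism, so FSMFF-type
would make it a composite of FSMI-morphisms, the first of which is an FSMI *endo*morphism — excluded in a
category of FSMFF-type (§0 p. 18, `IsOfFSMFFType.not_isFSMI_of_endomorphism`). Second clause: the arrows
`k → k + 1` of `Order(ℤ_{≥0})` are FSMI-morphisms, so `0 → 1 → ⋯ → N + 1` are FSMI-chains of unbounded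
length out of `0`, contradicting condition (b) of FSMFF-type (§0 p. 18).

No new definitions; nothing here is specific to the abc programme.
-/

namespace Literature.AlgebraicGeometry.Frobenioids

open CategoryTheory CategoryTheory.Limits

universe v u

/-! ### Nonempty and connected objects of a Galois category -/

section Galois

variable {C : Type u} [Category.{v} C]

/-- An object is nonempty in the sense of FrdI §0 p. 15 iff it is not an initial object.
[cite: MochizukiFrdI2008, §0 p.15] -/
theorem isNonemptyObj_iff_not_isInitial (A : C) : IsNonemptyObj A ↔ (IsInitial A → False) :=
  ⟨fun h hA => h.false hA, fun h => ⟨h⟩⟩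

/-- In a pre-Galois category, an object that is connected in the sense of FrdI §0 p. 15 (nonempty and
not a coproduct of two nonempty objects) is connected in the sense of SGA1 (Mathlib
`PreGaloisCategory.IsConnected`: not initial, and every monomorphism into it from a non-initial object
is an isomorphism): a monomorphism `Y → A` exhibits `A ≅ Y ⊔ Z`, and `Z` must then be empty.
[cite: MochizukiFrdI2008, Rem. 3.1.3 p.58] -/
theorem IsConnectedObj.isConnected [PreGaloisCategory C] {A : C} (hA : IsConnectedObj A) :
    PreGaloisCategory.IsConnected A where
  notInitial h := hA.1.false h
  noTrivialComponent Y i _ hY := by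
    obtain ⟨Z, u, ⟨hc⟩⟩ := PreGaloisCategory.monoInducesIsoOnDirectSummand i
    -- `Z` is initial, since `A` is not the coproduct of two nonempty objects
    have hZ : Nonempty (IsInitial Z) := by
      by_contra hZ
      exact (hA.2 Y Z i u ⟨hY⟩ ⟨fun h => hZ ⟨h⟩⟩).false hc
    obtain ⟨hZ⟩ := hZ
    exact (BinaryCofan.isColimit_iff_isIso_inl hZ (BinaryCofan.mk i u)).mp ⟨hc⟩

/-- In a Galois category, an object that is connected in the sense of SGA1 is connected in the sense
of FrdI §0 p. 15: if `A ≅ B₁ ⊔ B₂` with `B₁`, `B₂` nonempty, the coprojection `B₁ → A` is a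
monomorphism (coproduct inclusions are monic in a Galois category), hence an isomorphism, and counting
points of a fibre functor `F` gives `|F(A)| = |F(B₁)| + |F(B₂)|`, `|F(B₁)| = |F(A)|`, `|F(B₂)| ≠ 0`.
[cite: MochizukiFrdI2008, Rem. 3.1.3 p.58] -/
theorem isConnectedObj_of_isConnected [GaloisCategory C] (A : C) [PreGaloisCategory.IsConnected A] :
    IsConnectedObj A := by
  let F := PreGaloisCategory.GaloisCategory.getFiberFunctor C
  refine ⟨⟨PreGaloisCategory.IsConnected.notInitial⟩, fun B₁ B₂ ι₁ ι₂ hB₁ hB₂ => ⟨fun hc => ?_⟩⟩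
  haveI : Mono ι₁ := MonoCoprod.binaryCofan_inl _ hc
  haveI : IsIso ι₁ := PreGaloisCategory.IsConnected.noTrivialComponent B₁ ι₁ fun h => hB₁.false h
  have h₁ : Nat.card (F.obj A) = Nat.card (F.obj B₁) + Nat.card (F.obj B₂) := by
    rw [← PreGaloisCategory.card_fiber_coprod_eq_sum F B₁ B₂]
    exact PreGaloisCategory.card_fiber_eq_of_iso F
      (hc.coconePointUniqueUpToIso (colimit.isColimit (pair B₁ B₂)))
  have h₂ : Nat.card (F.obj B₁) = Nat.card (F.obj A) :=
    PreGaloisCategory.card_fiber_eq_of_iso F (asIso ι₁)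
  have h₃ : Nat.card (F.obj B₂) ≠ 0 :=
    PreGaloisCategory.non_zero_card_fiber_of_not_initial F B₂ fun h => hB₂.false h
  omega

/-- In a Galois category the connected objects in the sense of FrdI §0 p. 15 are exactly the connected
objects in the sense of SGA1 (Mathlib `PreGaloisCategory.IsConnected`).
[cite: MochizukiFrdI2008, Rem. 3.1.3 p.58] -/
theorem isConnectedObj_iff_isConnected [GaloisCategory C] (A : C) :
    IsConnectedObj A ↔ PreGaloisCategory.IsConnected A :=
  ⟨fun h => h.isConnected, fun _ => isConnectedObj_of_isConnected A⟩

/-- A monomorphism of the full subcategory `C⁰` of connected objects of a Galois category `C` is a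
monomorphism of `C`: two arrows `X ⇉ B` equalised by it agree on every connected component of `X`.
[cite: MochizukiFrdI2008, Rem. 3.1.3 p.58] -/
theorem ConnectedPart.mono_hom [GaloisCategory C] {A B : ConnectedPart C} (β : B ⟶ A) [Mono β] :
    Mono β.hom := by
  refine ⟨fun {X} f g hfg => ?_⟩
  obtain ⟨ι, Y, c, hc, hY, _⟩ := PreGaloisCategory.has_decomp_connected_components X
  refine Cofan.IsColimit.hom_ext hc _ _ fun i => ?_
  haveI := hY i
  have key : (ObjectProperty.homMk (c i ≫ f) :
      (⟨Y i, isConnectedObj_of_isConnected (Y i)⟩ : ConnectedPart C) ⟶ B) ≫ β =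
      ObjectProperty.homMk (c i ≫ g) ≫ β := by
    ext
    simp only [ObjectProperty.FullSubcategory.comp_hom, ObjectProperty.homMk_hom, Category.assoc, hfg]
  have h := congrArg InducedCategory.Hom.hom ((cancel_mono β).mp key)
  rw [cofan_mk_inj]
  exact h

/-- In the full subcategory `C⁰` of connected objects of a Galois category `C`, every monomorphism is an
isomorphism (it is a monomorphism of `C` from a nonempty object into a connected one).
[cite: MochizukiFrdI2008, Rem. 3.1.3 p.58] -/
theorem ConnectedPart.isIso_of_mono [GaloisCategory C] {A B : ConnectedPart C} (β : B ⟶ A) [Mono β] :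
    IsIso β := by
  have hA : IsConnectedObj A.obj := A.property
  have hB : IsConnectedObj B.obj := B.property
  haveI := hA.isConnected
  haveI := ConnectedPart.mono_hom β
  have : IsIso β.hom :=
    PreGaloisCategory.IsConnected.noTrivialComponent B.obj β.hom fun h => hB.1.false h
  exact (ObjectProperty.isIso_hom_iff β).mp this

variable (C) in
/-- **Remark 3.1.3**, third clause (FrdI p. 58): "a typical example of a 'base category' is
constituted by the subcategory of connected objects of a Galois category [which is easily verified to
be of FSM-type]" — every FSM-morphism (indeed every monomorphism) of `C⁰` is an isomorphism.
[cite: MochizukiFrdI2008, Rem. 3.1.3 p.58] -/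
theorem connectedPart_isOfFSMType [GaloisCategory C] : IsOfFSMType (ConnectedPart C) :=
  ⟨fun f hf => by haveI := hf.2; exact ConnectedPart.isIso_of_mono f⟩

variable (C) in
/-- **Remark 3.1.3**, third clause, FSMFF form (FrdI p. 58: "of FSM- [hence also of FSMFF-] type").
[cite: MochizukiFrdI2008, Rem. 3.1.3 p.58] -/
theorem connectedPart_isOfFSMFFType [GaloisCategory C] : IsOfFSMFFType (ConnectedPart C) :=
  (connectedPart_isOfFSMType C).isOfFSMFFType

end Galois

/-! ### The one-object category of `N_{≥1}` -/

section SingleObject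

/-- In the one-object category of a commutative left-cancellative monoid every arrow `b` is an
FSM-morphism: it is a monomorphism by cancellation, and `b ∘ γ = γ ∘ b` completes any `γ` to a
commutative square (FrdI §0 p. 14). [cite: MochizukiFrdI2008, §0 p.14] -/
theorem SingleObj.isFSM {M : Type u} [CommMonoid M] [IsLeftCancelMul M] {x y : SingleObj M}
    (b : x ⟶ y) : IsFSM b := by
  refine ⟨fun X γ => ?_, ⟨fun f g h => ?_⟩⟩
  · refine ⟨X, (γ : M), (b : M), ?_⟩
    show b * γ = γ * b
    exact mul_comm _ _
  · exact mul_left_cancel (h : b * f = b * g)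

/-- **Remark 3.1.3**, first clause (FrdI p. 58): the one-object category determined by the monoid
`N_{≥1}` is not of FSMFF-type. Proof: the arrow `2` is a non-invertible FSM-morphism; in a category of
FSMFF-type it would be a composite of FSMI-morphisms, the first of which is an FSMI endomorphism of the
unique object — but no endomorphism in a category of FSMFF-type is an FSMI-morphism (§0 p. 18).
[cite: MochizukiFrdI2008, Rem. 3.1.3 p.58] -/
theorem not_isOfFSMFFType_singleObj_pnat : ¬ IsOfFSMFFType (SingleObj ℕ+) := by
  intro h
  let b : (SingleObj.star ℕ+ ⟶ SingleObj.star ℕ+) := (2 : ℕ+)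
  have hb : IsFSM b := SingleObj.isFSM b
  have hb' : ¬ IsIso b := by
    intro hi
    have h1 : (2 : ℕ+) * (show ℕ+ from inv b) = 1 := IsIso.inv_hom_id b
    have h2 : ((2 : ℕ+) : ℕ) * ((show ℕ+ from inv b) : ℕ) = 1 := by
      rw [← PNat.mul_coe, h1, PNat.one_coe]
    have h3 : ((2 : ℕ+) : ℕ) = 2 := rfl
    rw [h3] at h2
    omega
  obtain ⟨n, hn⟩ := h.factors b hb hb'
  obtain ⟨X, ψ, hψ⟩ := hn.exists_isFSMI
  obtain rfl : X = SingleObj.star ℕ+ := Subsingleton.elim _ _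
  exact h.not_isFSMI_of_endomorphism ψ hψ

end SingleObject

/-! ### The category `Order(ℤ_{≥0})` -/

section OrderNat

/-- In `Order(ℤ_{≥0})` (`DivOrder (Multiplicative ℕ)`: objects the elements of `ℤ_{≥0}` written
multiplicatively, an arrow `a → b` iff `a ∣ b`, i.e. iff `a ≤ b` in `ℤ_{≥0}`) the order is the usual
order of `ℕ`. [cite: MochizukiFrdI2008, §0 p.12] -/
private theorem le_iff_toAdd_le (a b : DivOrder (Multiplicative ℕ)) :
    a ≤ b ↔ Multiplicative.toAdd a ≤ Multiplicative.toAdd b := by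
  change Dvd.dvd (α := Multiplicative ℕ) a b ↔ _
  constructor
  · rintro ⟨c, hc⟩
    rw [hc, toAdd_mul]
    exact Nat.le_add_right _ _
  · intro h
    obtain ⟨c, hc⟩ := Nat.exists_eq_add_of_le h
    exact ⟨Multiplicative.ofAdd c, Multiplicative.toAdd.injective (by simpa using hc)⟩

/-- An arrow `a → b` of `Order(ℤ_{≥0})` is an isomorphism iff `b ≤ a`. [cite: MochizukiFrdI2008, §0 p.12] -/
private theorem isIso_iff_le {a b : DivOrder (Multiplicative ℕ)} (f : a ⟶ b) : IsIso f ↔ b ≤ a :=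
  ⟨fun _ => (inv f).le, fun h => ⟨⟨h.hom, Subsingleton.elim _ _, Subsingleton.elim _ _⟩⟩⟩

/-- `Order(ℤ_{≥0})` has a least object `0`. [cite: MochizukiFrdI2008, §0 p.12] -/
private theorem exists_least : ∃ z : DivOrder (Multiplicative ℕ), ∀ X, z ≤ X :=
  ⟨(1 : Multiplicative ℕ), fun X => one_dvd (α := Multiplicative ℕ) X⟩

/-- Every object `a` of `Order(ℤ_{≥0})` has a successor `a + 1`. [cite: MochizukiFrdI2008, §0 p.12] -/
private theorem exists_succ (a : DivOrder (Multiplicative ℕ)) :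
    ∃ b : DivOrder (Multiplicative ℕ), Multiplicative.toAdd b = Multiplicative.toAdd a + 1 :=
  ⟨Multiplicative.ofAdd (Multiplicative.toAdd a + 1), toAdd_ofAdd _⟩

/-- An arrow `a → a + 1` of `Order(ℤ_{≥0})` is an FSMI-morphism: a monomorphism (the category is a
preorder), fiberwise-surjective (complete any `X → a + 1` through the least object `0`), not an
isomorphism, and irreducible (an intermediate object is `a` or `a + 1`).
[cite: MochizukiFrdI2008, Rem. 3.1.3 p.58] -/
private theorem isFSMI_of_succ {a b : DivOrder (Multiplicative ℕ)}
    (hab : Multiplicative.toAdd b = Multiplicative.toAdd a + 1) (f : a ⟶ b) : IsFSMI f := by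
  obtain ⟨z, hz⟩ := exists_least
  refine ⟨⟨fun X γ => ⟨z, (hz a).hom, (hz X).hom, Subsingleton.elim _ _⟩,
    ⟨fun _ _ _ => Subsingleton.elim _ _⟩⟩, ?_, fun X β α _ => ?_⟩
  · rw [isIso_iff_le, le_iff_toAdd_le]
    omega
  · have h₁ := (le_iff_toAdd_le _ _).1 β.le
    have h₂ := (le_iff_toAdd_le _ _).1 α.le
    rcases Nat.eq_or_lt_of_le h₁ with h | h
    · exact Or.inr ((isIso_iff_le β).2 ((le_iff_toAdd_le _ _).2 (by omega)))
    · exact Or.inl ((isIso_iff_le α).2 ((le_iff_toAdd_le _ _).2 (by omega)))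

/-- FSMI-chains `a → a + 1 → ⋯ → a + n + 1` of every length `n + 1` in `Order(ℤ_{≥0})`.
[cite: MochizukiFrdI2008, Rem. 3.1.3 p.58] -/
private theorem exists_isFSMIChain (n : ℕ) (a : DivOrder (Multiplicative ℕ)) :
    ∃ (B : DivOrder (Multiplicative ℕ)) (φ : a ⟶ B), IsFSMIChain φ (n + 1) := by
  induction n generalizing a with
  | zero =>
    obtain ⟨b, hb⟩ := exists_succ a
    exact ⟨b, ((le_iff_toAdd_le a b).2 (by omega)).hom, IsFSMIChain.single _ (isFSMI_of_succ hb _)⟩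
  | succ n ih =>
    obtain ⟨b, hb⟩ := exists_succ a
    obtain ⟨B, χ, hχ⟩ := ih b
    exact ⟨B, ((le_iff_toAdd_le a b).2 (by omega)).hom ≫ χ,
      IsFSMIChain.cons _ χ (n + 1) (isFSMI_of_succ hb _) hχ⟩

/-- **Remark 3.1.3**, second clause (FrdI p. 58): `Order(ℤ_{≥0})` is not of FSMFF-type — the
FSMI-chains `0 → 1 → ⋯ → N + 1` out of `0` have unbounded length, contradicting condition (b) of
§0 p. 18. [cite: MochizukiFrdI2008, Rem. 3.1.3 p.58] -/
theorem not_isOfFSMFFType_divOrder_nat : ¬ IsOfFSMFFType (DivOrder (Multiplicative ℕ)) := by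
  intro h
  obtain ⟨z, -⟩ := exists_least
  obtain ⟨N, hN⟩ := h.bounded z
  obtain ⟨B, φ, hφ⟩ := exists_isFSMIChain N z
  have := hN φ (N + 1) hφ
  omega

end OrderNat

/-- **Remark 3.1.3** (FrdI p. 58), DISCHARGED: the named fact `Remark313` of
`BaseCategoryTheoreticityDefs.lean` — `N_{≥1}` as a one-object category and `Order(ℤ_{≥0})` are not of
FSMFF-type, and the subcategory of connected objects of any Galois category is of FSM-type.
[cite: MochizukiFrdI2008, Rem. 3.1.3 p.58] -/
theorem Remark313_holds : Remark313.{v, u} :=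
  ⟨not_isOfFSMFFType_singleObj_pnat, not_isOfFSMFFType_divOrder_nat,
    fun G _ _ => connectedPart_isOfFSMType G⟩

end Literature.AlgebraicGeometry.Frobenioids
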